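/-
Copyright: the b2b-balaban T⁴-continuum CRUX team, row NE7b OWNER lineage `t4-ne7b-p1` (gen 141). Project licence.
-/
import Summits.QuantumFields.BalabanUV.T4Continuum.Spine.NE7b.SupWhitenedTwoPointEntries

/-!
# THE TWO-POINT PIECES OF `∂⁴W`, ENTRYWISE (I), FOR A GENERAL `Γ = AAᵀ` AND ANY ADMISSIBLE `D`: THE THIRD-DERIVATIVE-ENTRY OBSERVABLE AND
# `Cov(U‴e_xe_ye_z, U′e_t)` (SCOPING (d13)(2), the second of the non-cumulant pieces at order four).  In the cumulant form of `∂⁴W` the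
# two-point pieces are `Cov(U‴[e_x,e_y,e_z], U′[e_t])` (four placements of the lone slot) and `Cov(U″[e_x,e_y], U″[e_z,e_t])` (three
# pairings).  The third-derivative-entry observable `T_{xyz}(ξ) = U‴(Aξ+ψ)[e_x,e_y,e_z]` is `ξ`-Lipschitz with vector
# `k^{xyz}_w = Σ_u|A_{uw}|K4_{xyzu}` for the fourth kernel's entry majorant `|U⁗φ[e_u,e_x,e_y,e_z]| ≤ K4_{xyzu}` (the order-4 twin of (469)'s
# `hessian_obs_lipVec`), and (447)'s entry bound gives, for EVERY `D ≥ 0` with `δ + D·C ≤ D` (`C = HA∕(1−lamA)` off the diagonal),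
#   `|Cov_ν(T_{xyz}, F_t)| ≤ E_D(k^{xyz}, b^t)`,   `E_D(a,b) = Σ_w (Dᵀa)_w(Dᵀb)_w∕(1−lamA)`,   `b^t_w = Σ_u|A_{uw}|Hk_{tu}`
# — NO dependence on the background `ψ`: a two-point ENTRY of the output majorant `K4⁺` (the class map at order four); in tilted form under
# `N(0,AAᵀ)` with the moment letters discharged (row NE7b, node U5c; (447) `abs_cov_le_kernel_gibbs`, (456), (457), (458), (469), (477) BY
# NAME; [folklore])

Cell `pub-balaban`, sub-cell `t4`, spine estimate NE7b (`T4WeightBudget.RelWeightBound`; the cell's OWN estimate — NOT PRINTED in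
[Bałaban 1983–89], NOT PROVED).  Crux-route work under `Spine/NE7b/` by the row OWNER (`t4-ne7b-p1` gen 141, file (501)) under FREEZE
(0)'s crux-prover clause; NOTHING of Bałaban's is named as a Lean object, valued or asserted; no `T4Continuum/Support` leaf typed; no
`def`, no notation; zero `sorry`.  Imports (BY NAME): the OWNER's (477) `…SupWhitenedTwoPointEntries` (for its imports: (469) `hessian_obs_lipVec`,
(458) `whitened_exp_integrable`∕`whitened_second_moment_integrable`, (457) `whitenedV_*`, `whitened_integrable_lebesgue`,
`whitened_tilted_eq_gauss`, `whitened_integral_eq`, (456) `matrixCLM_single_apply`, `whitened_line`, `toLp_update_zero`,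
`whitened_obs_lipVec`, `whitened_cross_nonneg`, `whitened_J_rowsum_le`, (447) `abs_cov_le_kernel_gibbs`).

WHAT IS PROVED ([folklore]; any admissible `D`):
* §1 `expand_first_slot_four`, `hasDerivAt_line3`, `fourth_first_slot_majorant`, `third_obs_lipschitz`, `third_obs_lipVec`.
* §2 raw (whitened Lebesgue tilted format): `thirdgrad_cov_entry_raw`; §3 THE END under `N(0,AAᵀ)`: **`thirdgrad_cov_entry`**.

HONEST (what this is NOT).  One two-point entry; the lone-slot-first entry `Cov(U′e_x, U‴e_ye_ze_t)` and the Hessian–Hessian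
entry `Cov(U″e_xe_y, U″e_ze_t)` are the next file; their fixed-slot letters, the three-point pieces `κ₃(U″,U′,U′)`, the assembled majorant
and the cumulant FORM of `∂⁴W` (`U ∈ C⁴`) are NOT typed.  Scalar skeleton ((A3), NC-NE7b-α UNRULED); nothing of Bałaban's asserted.  BY-NAME EFFECT ON
THE WALL: NONE.  NE7b NOT PRINTED ∕ NOT PROVED; spine PROVED 0∕9; rung (B)+1 — the programme's measures remain FINITE-torus statements; NOT
the mass gap, NOT Clay.  HONEST DEPENDENCY: continuum YM on T⁴ ⇐ BetaPertH ∧ nine spine estimates (0∕9 proved); BetaPertH ⇐ (D1) ∧ (D4) ∧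
CAP+tail; G-an2-4 gates asym, D1 and NE2∕3∕4.
-/

set_option autoImplicit false
set_option maxSynthPendingDepth 3

noncomputable section

namespace Summit.QuantumFields.BalabanUV.T4Continuum.NE7b.SupWhitenedFourthTwoPointEntries

open MeasureTheory ProbabilityTheory Real Set Function Finset Matrix
open scoped BigOperators
open Literature.Probability.Distributions (matrixCLM)
open SupWhitenedMomentLetters (whitened_exp_integrable whitened_second_moment_integrable)
open SupWhitenedCovarianceKernelLetter (whitenedV_hasDerivAt whitenedV_floor whitenedV_ceiling whitenedV_cross whitenedV_continuous
  whitened_integrable_lebesgue whitened_tilted_eq_gauss whitened_integral_eq)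
open SupWhitenedFirstOrderLetters (matrixCLM_single_apply whitened_line toLp_update_zero whitened_obs_lipVec whitened_cross_nonneg
  whitened_J_rowsum_le)
open SupWhitenedHessianGradientCovariance (hessian_obs_lipVec)
open SupDobrushinCovarianceGibbs (abs_cov_le_kernel_gibbs)

variable {ι κ : Type} [Fintype ι] [DecidableEq ι] [Fintype κ] [DecidableEq κ]

variable {U : EuclideanSpace ℝ ι → ℝ} {U' : EuclideanSpace ℝ ι → EuclideanSpace ℝ ι →L[ℝ] ℝ}
  {U'' : EuclideanSpace ℝ ι → EuclideanSpace ℝ ι →L[ℝ] EuclideanSpace ℝ ι →L[ℝ] ℝ}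
  {U₃ : EuclideanSpace ℝ ι → EuclideanSpace ℝ ι →L[ℝ] EuclideanSpace ℝ ι →L[ℝ] EuclideanSpace ℝ ι →L[ℝ] ℝ}
  {U₄ : EuclideanSpace ℝ ι → EuclideanSpace ℝ ι →L[ℝ] EuclideanSpace ℝ ι →L[ℝ] EuclideanSpace ℝ ι →L[ℝ] EuclideanSpace ℝ ι →L[ℝ] ℝ}
  {Hk : ι → ι → ℝ} {K3 : ι → ι → ι → ℝ} {K4 : ι → ι → ι → ι → ℝ} {A : Matrix ι κ ℝ} {D : κ → κ → ℝ} {γop κ₀ τ δ θ αr αc hr lamA γ : ℝ}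

/-! ## §1. The third-derivative-entry observable `T_{xyz}(ξ) = U‴(Aξ+ψ)[e_x,e_y,e_z]` -/

/-- **Expansion of the first slot of a `4`-linear form**: `Q v h k l = Σ_u v_u · Q e_u h k l`. [folklore] -/
theorem expand_first_slot_four (Q : EuclideanSpace ℝ ι →L[ℝ] EuclideanSpace ℝ ι →L[ℝ] EuclideanSpace ℝ ι →L[ℝ] EuclideanSpace ℝ ι →L[ℝ] ℝ)
    (v h k l : EuclideanSpace ℝ ι) : Q v h k l = ∑ u, v u * Q (EuclideanSpace.single u (1 : ℝ)) h k l := by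
  have hv : v = ∑ u, v u • EuclideanSpace.single u (1 : ℝ) := by
    have h := (EuclideanSpace.basisFun ι ℝ).sum_repr v
    simp only [EuclideanSpace.basisFun_repr, EuclideanSpace.basisFun_apply] at h
    exact h.symm
  conv_lhs => rw [hv]
  simp

omit [DecidableEq ι] in
/-- `s ↦ U‴(φ + s•v)[h,k,l]` has derivative `U⁗(φ + s•v)[v,h,k,l]`. [folklore] -/
theorem hasDerivAt_line3 (hU₃d : ∀ ψ : EuclideanSpace ℝ ι, HasFDerivAt U₃ (U₄ ψ) ψ) (φ v h k l : EuclideanSpace ℝ ι) (s : ℝ) :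
    HasDerivAt (fun s : ℝ => U₃ (φ + s • v) h k l) (U₄ (φ + s • v) v h k l) s := by
  have hl : HasDerivAt (fun s : ℝ => φ + s • v) v s := by simpa using ((hasDerivAt_id s).smul_const v).const_add φ
  have h1 := (hU₃d (φ + s • v)).comp_hasDerivAt s hl
  have h2 := (((ContinuousLinearMap.apply ℝ ℝ l).comp (ContinuousLinearMap.apply ℝ (EuclideanSpace ℝ ι →L[ℝ] ℝ) k)).comp
    (ContinuousLinearMap.apply ℝ (EuclideanSpace ℝ ι →L[ℝ] EuclideanSpace ℝ ι →L[ℝ] ℝ) h)).hasFDerivAt.comp_hasDerivAt s h1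
  simpa [Function.comp_def] using h2

/-- **First-slot majorant of the fourth derivative**: `|U⁗φ(Ae_w)e_xe_ye_z| ≤ Σ_u|A_{uw}|K4_{xyzu}`. [folklore] -/
theorem fourth_first_slot_majorant (hK4 : ∀ (φ : EuclideanSpace ℝ ι) (u x y z : ι), |U₄ φ (EuclideanSpace.single u (1 : ℝ)) (EuclideanSpace.single x
    (1 : ℝ))
      (EuclideanSpace.single y (1 : ℝ)) (EuclideanSpace.single z (1 : ℝ))| ≤ K4 x y z u)
    (A : Matrix ι κ ℝ) (φ : EuclideanSpace ℝ ι) (w : κ) (x y z : ι) :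
    |U₄ φ (matrixCLM A (EuclideanSpace.single w (1 : ℝ))) (EuclideanSpace.single x (1 : ℝ)) (EuclideanSpace.single y (1 : ℝ))
        (EuclideanSpace.single z (1 : ℝ))| ≤ ∑ u, |A u w| * K4 x y z u := by
  rw [expand_first_slot_four (U₄ φ)]
  refine (Finset.abs_sum_le_sum_abs _ _).trans (Finset.sum_le_sum fun u _ => ?_)
  rw [abs_mul, matrixCLM_single_apply]
  exact mul_le_mul_of_nonneg_left (hK4 φ u x y z) (abs_nonneg _)

/-- **The third-derivative-entry observable is `ξ`-Lipschitz** (shift format):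
`|U‴(A(ξ + r•e_w)+ψ)e_xe_ye_z − U‴(Aξ+ψ)e_xe_ye_z| ≤ (Σ_u|A_{uw}|K4_{xyzu})·|r|`. [folklore] -/
theorem third_obs_lipschitz (hU₃d : ∀ φ : EuclideanSpace ℝ ι, HasFDerivAt U₃ (U₄ φ) φ)
    (hK4 : ∀ (φ : EuclideanSpace ℝ ι) (u x y z : ι), |U₄ φ (EuclideanSpace.single u (1 : ℝ)) (EuclideanSpace.single x (1 : ℝ))
      (EuclideanSpace.single y (1 : ℝ)) (EuclideanSpace.single z (1 : ℝ))| ≤ K4 x y z u)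
    (A : Matrix ι κ ℝ) (ψ : EuclideanSpace ℝ ι) (x y z : ι) (w : κ) (ξ : EuclideanSpace ℝ κ) (r : ℝ) :
    |U₃ (matrixCLM A (ξ + r • EuclideanSpace.single w (1 : ℝ)) + ψ) (EuclideanSpace.single x (1 : ℝ)) (EuclideanSpace.single y (1 : ℝ))
          (EuclideanSpace.single z (1 : ℝ)) -
        U₃ (matrixCLM A ξ + ψ) (EuclideanSpace.single x (1 : ℝ)) (EuclideanSpace.single y (1 : ℝ)) (EuclideanSpace.single z (1 : ℝ))| ≤
      (∑ u, |A u w| * K4 x y z u) * |r| := by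
  rw [whitened_line]
  set φ : EuclideanSpace ℝ ι := matrixCLM A ξ + ψ
  have hd : ∀ s ∈ (univ : Set ℝ), HasDerivWithinAt (fun s : ℝ => U₃ (φ + s • matrixCLM A (EuclideanSpace.single w (1 : ℝ)))
      (EuclideanSpace.single x (1 : ℝ)) (EuclideanSpace.single y (1 : ℝ)) (EuclideanSpace.single z (1 : ℝ)))
      (U₄ (φ + s • matrixCLM A (EuclideanSpace.single w (1 : ℝ))) (matrixCLM A (EuclideanSpace.single w (1 : ℝ))) (EuclideanSpace.single x (1 : ℝ))
        (EuclideanSpace.single y (1 : ℝ)) (EuclideanSpace.single z (1 : ℝ))) univ s :=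
    fun s _ => (hasDerivAt_line3 hU₃d φ _ _ _ _ s).hasDerivWithinAt
  have hb : ∀ s ∈ (univ : Set ℝ), ‖U₄ (φ + s • matrixCLM A (EuclideanSpace.single w (1 : ℝ))) (matrixCLM A (EuclideanSpace.single w (1 : ℝ)))
      (EuclideanSpace.single x (1 : ℝ)) (EuclideanSpace.single y (1 : ℝ)) (EuclideanSpace.single z (1 : ℝ))‖ ≤ ∑ u, |A u w| * K4 x y z u :=
    fun s _ => by
    rw [Real.norm_eq_abs]
    exact fourth_first_slot_majorant hK4 A _ w x y z
  have h := convex_univ.norm_image_sub_le_of_norm_hasDerivWithin_le hd hb (mem_univ 0) (mem_univ r)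
  simp only [zero_smul, add_zero, sub_zero, Real.norm_eq_abs] at h
  exact h

/-- **The third-derivative-entry observable in (447)'s `update` format**:
`|T_{xyz}(ζ^{w,s}) − T_{xyz}(ζ^{w,t})| ≤ (Σ_u|A_{uw}|K4_{xyzu})·|s − t|`. [folklore] -/
theorem third_obs_lipVec (hU₃d : ∀ φ : EuclideanSpace ℝ ι, HasFDerivAt U₃ (U₄ φ) φ)
    (hK4 : ∀ (φ : EuclideanSpace ℝ ι) (u x y z : ι), |U₄ φ (EuclideanSpace.single u (1 : ℝ)) (EuclideanSpace.single x (1 : ℝ))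
      (EuclideanSpace.single y (1 : ℝ)) (EuclideanSpace.single z (1 : ℝ))| ≤ K4 x y z u)
    (A : Matrix ι κ ℝ) (ψ : EuclideanSpace ℝ ι) (x y z : ι) (w : κ) (ζ : κ → ℝ) (s t : ℝ) :
    |U₃ (matrixCLM A (WithLp.toLp 2 (update ζ w s)) + ψ) (EuclideanSpace.single x (1 : ℝ)) (EuclideanSpace.single y (1 : ℝ))
          (EuclideanSpace.single z (1 : ℝ)) -
        U₃ (matrixCLM A (WithLp.toLp 2 (update ζ w t)) + ψ) (EuclideanSpace.single x (1 : ℝ)) (EuclideanSpace.single y (1 : ℝ))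
          (EuclideanSpace.single z (1 : ℝ))| ≤ (∑ u, |A u w| * K4 x y z u) * |s - t| := by
  rw [toLp_update_zero ζ w s t]
  exact third_obs_lipschitz hU₃d hK4 A ψ x y z w _ (s - t)

/-! ## §2. The raw entry (whitened Lebesgue tilted format, any admissible `D`) -/

/-- **`|Cov_ν(T_{xyz}, F_t)| ≤ E_D(k^{xyz}, b^t)`** in the whitened Lebesgue format, any admissible `D`. [folklore] -/
theorem thirdgrad_cov_entry_raw (hUd : ∀ φ : EuclideanSpace ℝ ι, HasFDerivAt U (U' φ) φ) (hU'd : ∀ φ : EuclideanSpace ℝ ι, HasFDerivAt U' (U'' φ) φ)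
    (hU₃d : ∀ φ : EuclideanSpace ℝ ι, HasFDerivAt U₃ (U₄ φ) φ)
    (hHk : ∀ (φ : EuclideanSpace ℝ ι) (x z : ι), |U'' φ (EuclideanSpace.single z (1 : ℝ)) (EuclideanSpace.single x (1 : ℝ))| ≤ Hk x z)
    (hHk0 : ∀ v u, 0 ≤ Hk v u)
    (hK4 : ∀ (φ : EuclideanSpace ℝ ι) (u x y z : ι), |U₄ φ (EuclideanSpace.single u (1 : ℝ)) (EuclideanSpace.single x (1 : ℝ))
      (EuclideanSpace.single y (1 : ℝ)) (EuclideanSpace.single z (1 : ℝ))| ≤ K4 x y z u)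
    (A : Matrix ι κ ℝ) (ψ : EuclideanSpace ℝ ι)
    (hlam : ∀ x : κ, ∑ u, ∑ v, |A u x| * |A v x| * Hk v u ≤ lamA) (hlam1 : lamA < 1)
    (hrow : ∀ x : κ, ∑ w, (if w = x then 0 else ∑ u, ∑ v, |A u w| * |A v x| * Hk v u) / (1 - lamA) ≤ γ) (hγ0 : 0 ≤ γ) (hγ1 : γ < 1)
    (hD : ∀ x y, 0 ≤ D x y)
    (hDC : ∀ x y, (if x = y then (1 : ℝ) else 0) + ∑ z, D x z * ((if y = z then 0 else ∑ u, ∑ v, |A u y| * |A v z| * Hk v u) / (1 - lamA)) ≤ D x y)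
    (hI0 : Integrable (fun ξ : EuclideanSpace ℝ κ => exp (-U (matrixCLM A ξ + ψ))) (multivariateGaussian 0 (1 : Matrix κ κ ℝ)))
    (hI2 : ∀ w, Integrable (fun ξ : EuclideanSpace ℝ κ => exp (-U (matrixCLM A ξ + ψ)) * ξ w ^ 2) (multivariateGaussian 0 (1 : Matrix κ κ ℝ)))
    (x y z t : ι) :
    |∫ w, U₃ (matrixCLM A (WithLp.toLp 2 w) + ψ) (EuclideanSpace.single x (1 : ℝ)) (EuclideanSpace.single y (1 : ℝ)) (EuclideanSpace.single z (1 :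
        ℝ)) *
            U' (matrixCLM A (WithLp.toLp 2 w) + ψ) (EuclideanSpace.single t (1 : ℝ))
          ∂((volume : Measure (κ → ℝ)).tilted fun z => -(1 / 2 * (z ⬝ᵥ z) + U (matrixCLM A (WithLp.toLp 2 z) + ψ))) -
        (∫ w, U₃ (matrixCLM A (WithLp.toLp 2 w) + ψ) (EuclideanSpace.single x (1 : ℝ)) (EuclideanSpace.single y (1 : ℝ)) (EuclideanSpace.single z (1
            : ℝ))
          ∂((volume : Measure (κ → ℝ)).tilted fun z => -(1 / 2 * (z ⬝ᵥ z) + U (matrixCLM A (WithLp.toLp 2 z) + ψ)))) *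
        (∫ w, U' (matrixCLM A (WithLp.toLp 2 w) + ψ) (EuclideanSpace.single t (1 : ℝ))
          ∂((volume : Measure (κ → ℝ)).tilted fun z => -(1 / 2 * (z ⬝ᵥ z) + U (matrixCLM A (WithLp.toLp 2 z) + ψ))))| ≤
      ∑ w, (∑ z', D z' w * ∑ u, |A u z'| * K4 x y z u) * (∑ z', D z' w * ∑ u, |A u z'| * Hk t u) / (1 - lamA) := by
  have hcpos : ∀ _x : κ, 0 < 1 - lamA := fun _ => by linarith
  have hV0 : Integrable (fun z : κ → ℝ => exp (-(1 / 2 * (z ⬝ᵥ z) + U (matrixCLM A (WithLp.toLp 2 z) + ψ)))) := by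
    have h := whitened_integrable_lebesgue A ψ (k := fun _ => (1 : ℝ)) (by simpa only [mul_one] using hI0)
    simpa only [one_mul] using h
  have hV2 : ∀ w, Integrable (fun z : κ → ℝ => z w ^ 2 * exp (-(1 / 2 * (z ⬝ᵥ z) + U (matrixCLM A (WithLp.toLp 2 z) + ψ)))) := fun w => by
    have h := whitened_integrable_lebesgue A ψ (k := fun ξ : EuclideanSpace ℝ κ => ξ w ^ 2) (hI2 w)
    simpa only [PiLp.toLp_apply] using h
  have hJ : ∀ x w : κ, 0 ≤ (if w = x then (0 : ℝ) else ∑ u, ∑ v, |A u w| * |A v x| * Hk v u) := fun x w => by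
    split_ifs
    · exact le_rfl
    · exact whitened_cross_nonneg hHk0 A x w
  exact abs_cov_le_kernel_gibbs
    (P := fun x F ω => (∫ s, F (update ω x s) * exp (-(1 / 2 * (update ω x s ⬝ᵥ update ω x s) + U (matrixCLM A (WithLp.toLp 2 (update ω x s)) + ψ))))
        /
      ∫ s, exp (-(1 / 2 * (update ω x s ⬝ᵥ update ω x s) + U (matrixCLM A (WithLp.toLp 2 (update ω x s)) + ψ))))
    (V := fun z => 1 / 2 * (z ⬝ᵥ z) + U (matrixCLM A (WithLp.toLp 2 z) + ψ))
    (V₁ := fun x z => z x + U' (matrixCLM A (WithLp.toLp 2 z) + ψ) (matrixCLM A (EuclideanSpace.single x (1 : ℝ))))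
    (c := fun _ => 1 - lamA) (Cw := 1 + lamA) (J := fun x w => if w = x then 0 else ∑ u, ∑ v, |A u w| * |A v x| * Hk v u) (γ := γ) (D := D)
    (F := fun w => U₃ (matrixCLM A (WithLp.toLp 2 w) + ψ) (EuclideanSpace.single x (1 : ℝ)) (EuclideanSpace.single y (1 : ℝ)) (EuclideanSpace.single
        z (1 : ℝ)))
    (G := fun w => U' (matrixCLM A (WithLp.toLp 2 w) + ψ) (EuclideanSpace.single t (1 : ℝ)))
    (a := fun w => ∑ u, |A u w| * K4 x y z u) (b := fun w => ∑ u, |A u w| * Hk t u)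
    (fun _ _ _ => rfl) (fun x z => whitenedV_hasDerivAt hUd A ψ x z) (fun x z s t => whitenedV_floor hU'd hHk A hlam ψ x z s t) hcpos
    (fun x z s t => whitenedV_ceiling hU'd hHk A hlam ψ x z s t)
    (fun x w hw z s t => by rw [if_neg hw]; exact whitenedV_cross hU'd hHk A ψ x w hw z s t)
    (whitenedV_continuous hUd A ψ) hV0 hV2 hJ (fun x => by simp) hrow hγ0 hγ1 hD hDC
    (fun w z' s₁ s₂ => third_obs_lipVec hU₃d hK4 A ψ x y z w z' s₁ s₂)
    (fun w z' s₁ s₂ => whitened_obs_lipVec hU'd hHk A ψ t w z' s₁ s₂)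

/-! ## §3. THE END: the entry under `N(0, AAᵀ)` -/

/-- **`|Z⁻¹∫e^{−U}U‴e_xe_ye_z·U′e_t − Z⁻²(∫e^{−U}U‴e_xe_ye_z)(∫e^{−U}U′e_t)| ≤ E_D(k^{xyz}, b^t)`**
under `N(0,AAᵀ)`, any admissible `D`, the moment letters discharged by (458), Dobrushin's row condition from the letters `αc·hr·αr ≤ γ(1−lamA)`.
[folklore] -/
theorem thirdgrad_cov_entry [Nonempty κ] (hΓop : (γop • (1 : Matrix ι ι ℝ) - A * Aᵀ).PosSemidef) (Y : Finset ι)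
    (hUd : ∀ φ : EuclideanSpace ℝ ι, HasFDerivAt U (U' φ) φ) (hU'd : ∀ φ : EuclideanSpace ℝ ι, HasFDerivAt U' (U'' φ) φ)
    (hU₃d : ∀ φ : EuclideanSpace ℝ ι, HasFDerivAt U₃ (U₄ φ) φ)
    (hHk : ∀ (φ : EuclideanSpace ℝ ι) (x z : ι), |U'' φ (EuclideanSpace.single z (1 : ℝ)) (EuclideanSpace.single x (1 : ℝ))| ≤ Hk x z)
    (hHk0 : ∀ v u, 0 ≤ Hk v u)
    (hK4 : ∀ (φ : EuclideanSpace ℝ ι) (u x y z : ι), |U₄ φ (EuclideanSpace.single u (1 : ℝ)) (EuclideanSpace.single x (1 : ℝ))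
      (EuclideanSpace.single y (1 : ℝ)) (EuclideanSpace.single z (1 : ℝ))| ≤ K4 x y z u)
    (hκ₀ : 0 ≤ κ₀) (hτ : 0 < τ) (hδ : 0 < δ) (hθ1 : θ < 1) (hκθ : 2 * κ₀ * (1 + τ) * γop ≤ θ)
    (hκθw : 2 * κ₀ * (1 + τ) * γop + 4 * δ ≤ θ) (hstab : ∀ φ : EuclideanSpace ℝ ι, -(κ₀ * ∑ x ∈ Y, φ x ^ 2) ≤ U φ) (ψ : EuclideanSpace ℝ ι)
    (hαr : ∀ u, ∑ w, |A u w| ≤ αr) (hαc : ∀ w, ∑ u, |A u w| ≤ αc) (hhr : ∀ v, ∑ u, Hk v u ≤ hr)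
    (hlam : ∀ x : κ, ∑ u, ∑ v, |A u x| * |A v x| * Hk v u ≤ lamA) (hlam1 : lamA < 1) (hγ : αc * hr * αr / (1 - lamA) ≤ γ) (hγ1 : γ < 1)
    (hD : ∀ x y, 0 ≤ D x y)
    (hDC : ∀ x y, (if x = y then (1 : ℝ) else 0) + ∑ z, D x z * ((if y = z then 0 else ∑ u, ∑ v, |A u y| * |A v z| * Hk v u) / (1 - lamA)) ≤ D x y)
    (x y z t : ι) :
    |((∫ ω : EuclideanSpace ℝ ι, exp (-U (ω + ψ)) ∂(multivariateGaussian 0 (A * Aᵀ)))⁻¹ * (∫ ω : EuclideanSpace ℝ ι, exp (-U (ω + ψ)) *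
          (U₃ (ω + ψ) (EuclideanSpace.single x (1 : ℝ)) (EuclideanSpace.single y (1 : ℝ)) (EuclideanSpace.single z (1 : ℝ)) * U' (ω + ψ)
              (EuclideanSpace.single t (1 : ℝ)))
            ∂(multivariateGaussian 0 (A * Aᵀ))) - ((∫ ω : EuclideanSpace ℝ ι, exp (-U (ω + ψ)) ∂(multivariateGaussian 0 (A * Aᵀ))) ^ 2)⁻¹ *
          ((∫ ω : EuclideanSpace ℝ ι, exp (-U (ω + ψ)) * U₃ (ω + ψ) (EuclideanSpace.single x (1 : ℝ)) (EuclideanSpace.single y (1 : ℝ))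
              (EuclideanSpace.single z (1 : ℝ))
            ∂(multivariateGaussian 0 (A * Aᵀ))) * (∫ ω : EuclideanSpace ℝ ι, exp (-U (ω + ψ)) * U' (ω + ψ) (EuclideanSpace.single t (1 : ℝ))
            ∂(multivariateGaussian 0 (A * Aᵀ)))))| ≤
      ∑ w, (∑ z', D z' w * ∑ u, |A u z'| * K4 x y z u) * (∑ z', D z' w * ∑ u, |A u z'| * Hk t u) / (1 - lamA) := by
  haveI : Nonempty ι := ⟨x⟩
  obtain ⟨w₀⟩ := ‹Nonempty κ›
  have hUc : Continuous U := continuous_iff_continuousAt.2 fun φ => (hUd φ).continuousAt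
  have hU'c : Continuous U' := continuous_iff_continuousAt.2 fun φ => (hU'd φ).continuousAt
  have hU₃c : Continuous U₃ := continuous_iff_continuousAt.2 fun φ => (hU₃d φ).continuousAt
  have hl1 : 0 < 1 - lamA := by linarith
  have hrow : ∀ x : κ, ∑ w, (if w = x then 0 else ∑ u, ∑ v, |A u w| * |A v x| * Hk v u) / (1 - lamA) ≤ γ := fun x => by
    rw [← Finset.sum_div]
    refine le_trans (div_le_div_of_nonneg_right ?_ hl1.le) hγ
    refine le_trans (Finset.sum_le_sum fun w _ => ?_) (whitened_J_rowsum_le hHk0 hαr hαc hhr x)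
    split_ifs
    · exact le_rfl
    · linarith [abs_nonneg ((1 : Matrix κ κ ℝ) x w)]
  have hγ0 : 0 ≤ γ := by
    refine le_trans (Finset.sum_nonneg fun w _ => div_nonneg ?_ hl1.le) (hrow w₀)
    split_ifs
    · exact le_rfl
    · exact whitened_cross_nonneg hHk0 A w₀ w
  have hI0 := whitened_exp_integrable hΓop Y hUc.measurable hκ₀ hτ hθ1 hκθ hstab ψ
  have hI2 := fun w => whitened_second_moment_integrable hΓop Y hUc.measurable hκ₀ hτ hδ hθ1 hκθw hstab ψ w
  have h := thirdgrad_cov_entry_raw hUd hU'd hU₃d hHk hHk0 hK4 A ψ hlam hlam1 hrow hγ0 hγ1 hD hDC hI0 hI2 x y z t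
  have hsh : Continuous fun ω : EuclideanSpace ℝ ι => ω + ψ := continuous_id.add continuous_const
  have he : Continuous fun ω : EuclideanSpace ℝ ι => exp (-U (ω + ψ)) := continuous_exp.comp (hUc.comp hsh).neg
  have hFc : Continuous fun ω : EuclideanSpace ℝ ι => U₃ (ω + ψ) (EuclideanSpace.single x (1 : ℝ)) (EuclideanSpace.single y (1 : ℝ))
      (EuclideanSpace.single z (1 : ℝ)) :=
    (((hU₃c.comp hsh).clm_apply continuous_const).clm_apply continuous_const).clm_apply continuous_const
  have hGc : Continuous fun ω : EuclideanSpace ℝ ι => U' (ω + ψ) (EuclideanSpace.single t (1 : ℝ)) :=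
    (hU'c.comp hsh).clm_apply continuous_const
  have hm0 : AEStronglyMeasurable (fun ω : EuclideanSpace ℝ ι => exp (-U (ω + ψ))) (multivariateGaussian 0 (A * Aᵀ)) := he.aestronglyMeasurable
  have hmF : AEStronglyMeasurable (fun ω : EuclideanSpace ℝ ι => exp (-U (ω + ψ)) * U₃ (ω + ψ) (EuclideanSpace.single x (1 : ℝ))
      (EuclideanSpace.single y (1 : ℝ)) (EuclideanSpace.single z (1 : ℝ))) (multivariateGaussian 0 (A * Aᵀ)) :=
    (he.mul hFc).aestronglyMeasurable
  have hmG : AEStronglyMeasurable (fun ω : EuclideanSpace ℝ ι => exp (-U (ω + ψ)) * U' (ω + ψ) (EuclideanSpace.single t (1 : ℝ)))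
      (multivariateGaussian 0 (A * Aᵀ)) :=
    (he.mul hGc).aestronglyMeasurable
  have hm2 : AEStronglyMeasurable (fun ω : EuclideanSpace ℝ ι => exp (-U (ω + ψ)) * (U₃ (ω + ψ) (EuclideanSpace.single x (1 : ℝ))
      (EuclideanSpace.single y (1 : ℝ)) (EuclideanSpace.single z (1 : ℝ)) * U' (ω + ψ) (EuclideanSpace.single t (1 : ℝ)))) (multivariateGaussian 0 (A
      * Aᵀ)) :=
    (he.mul (hFc.mul hGc)).aestronglyMeasurable
  refine le_trans (le_of_eq ?_) h
  rw [whitened_tilted_eq_gauss A ψ, whitened_tilted_eq_gauss A ψ, whitened_tilted_eq_gauss A ψ]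
  simp only [WithLp.toLp_ofLp]
  rw [whitened_integral_eq A hm0, whitened_integral_eq A hm2, whitened_integral_eq A hmF, whitened_integral_eq A hmG]
  congr 1
  ring

end Summit.QuantumFields.BalabanUV.T4Continuum.NE7b.SupWhitenedFourthTwoPointEntries

end
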